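import Summits.HodgeConjecture.HodgeConjecture.Theorems.PadicSemiregularLiftHodgeFermatVarietiesFibreOfTopLevelEight
import Summits.HodgeConjecture.HodgeConjecture.Theorems.PadicSemiregularLiftHodgeFermatVarietiesExistsFibreOfNotPaired
import HarnessLib

/-!
# A non-paired Hodge octuple at a level prime to `30` contains six points of a `7`-progression — line `cancel-by-any-claim-lattice`, crux `HodgeFermatVarieties` (stmt-HodgeConjecture-1334)

Lead c4's programme G8, registered stub G8-L2 `stub_exists_fibre_of_not_paired_eight`: for `m` coprime to `30`
with `49 ∤ m`, a Hodge octuple `s` of `ℤ/m` with `count x s ≠ count (-x) s` for some `x` contains all but one of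
the seven points `A + j(m/7)` (`j < 7`) of a progression with `7A ≠ 0`. Proof (the sextuple file
`…ExistsFibreOfNotPaired` one dimension up): realise `s` as a character `α : Fin 8 → ℤ/m`; the level of an entry
with asymmetric multiplicity is non-even; take the non-even level `M` with the least `m/M` (so every proper
multiple of `M` is even) and apply the level analysis `PairedNull.fibre_of_top_level_eight`
(`…FibreOfTopLevelEight`): `M = 7n` and a full fibre `{crt⁻¹(y, b)}` of unit parts of level-`M` entries; with
`x₀ = crt⁻¹(0, b)` and `A = (m/M)·⟨x₀⟩` the entries above the fibre are `A + j(m/7)`, `j = 1, …, 6` (the lift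
`x ↦ (m/M)·⟨x⟩` is additive, `divMul_val_add`, and `crt⁻¹(jn, b) = x₀ + jn`), and `7A = (m/n)·⟨x₀⟩ ≠ 0` because
`x₀ ≡ b (mod n)` is a unit and `n > 1` (`divMul_natCast_eq_zero_iff`). The helper lemmas are imported from the
sextuple file, not re-declared.

References: [Aoki1983] N. Aoki, Math. Ann. 266 (1983) 23–54, Thm. A′ (§7), Prop. 2.1.
-/

-- every sibling file of the line declares into `…CancelByAnyClaimLattice.PairedNull` from a differently named module
set_option linter.dupNamespace false

noncomputable section

open Finset
open Literature.AlgebraicGeometry.HodgeTheory Literature.AlgebraicGeometry.HodgeTheory.FermatCharacter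

namespace Summit.HodgeConjecture.HodgeConjecture.Theorems.CancelByAnyClaimLattice

namespace PairedNull

/-! ### From the fibre to the progression: the registered stub G8-L2 -/

section ProgressionEight

/-- **G8-L2 `stub_exists_fibre_of_not_paired_eight`** — a non-paired Hodge octuple at a level `m` prime to `30`
(`49 ∤ m`) contains all but one of the seven points of a progression `{A + j(m/7)}` with `7A ≠ 0`
(from `fibre_of_top_level_eight` at the top non-even level `M = 7n`: `A = (m/M)·⟨crt⁻¹(0, b)⟩`, the excluded
point `j₀ = 0` being the non-unit point of the fibre). [cite: Aoki1983, Thm. A′ (§7)] -/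
theorem stub_exists_fibre_of_not_paired_eight : ∀ (m : ℕ) [NeZero m], m.Coprime 30 → ¬ 49 ∣ m → ∀ s : Multiset (ZMod m), IsHodgeMultiset s → Multiset.card s = 8 → (∃ x : ZMod m, Multiset.count x s ≠ Multiset.count (-x) s) → 7 ∣ m ∧ ∃ A : ZMod m, (7 : ZMod m) * A ≠ 0 ∧ ∃ j₀ : ℕ, j₀ < 7 ∧ ∀ j : ℕ, j < 7 → j ≠ j₀ → A + (j : ZMod m) * ((m / 7 : ℕ) : ZMod m) ∈ s := by
  intro m _ hm h49 s hs h8 hns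
  classical
  have hm0 : m ≠ 0 := NeZero.ne m
  obtain ⟨r, α, hα, rfl⟩ := hs.exists_isHodge
  have hr : r = 8 := by rw [card_univ_val_map] at h8; exact h8
  subst hr
  -- the non-even level of some entry
  obtain ⟨x, hx⟩ := hns
  rw [count_univ_val_map, count_univ_val_map] at hx
  have hx0 : x ≠ 0 := by
    rintro rfl
    rw [neg_zero] at hx
    exact hx rfl
  have hfibre : ∀ (M : ℕ) (y : ZMod m), m / m.gcd y.val = M →
      (univ.filter fun i : Fin 8 ↦ α i = y) =
        univ.filter fun i : Fin 8 ↦ m / m.gcd (α i).val = M ∧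
          ((((α i).val / (m / M)) : ℕ) : ZMod M) = (((y.val / (m / M)) : ℕ) : ZMod M) := by
    intro M y hy
    ext i
    simp only [mem_filter, mem_univ, true_and]
    constructor
    · rintro rfl; exact ⟨hy, rfl⟩
    · rintro ⟨hli, hri⟩
      exact eq_of_level_eq_of_unitPart_eq hli hy hri
  set P : ℕ → Prop := fun d ↦ ∃ M : ℕ, M ∣ m ∧ m / M = d ∧ ∃ v : ZMod M,
      #(univ.filter fun i : Fin 8 ↦ m / m.gcd (α i).val = M ∧ ((((α i).val / (m / M)) : ℕ) : ZMod M) = -v) ≠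
      #(univ.filter fun i : Fin 8 ↦ m / m.gcd (α i).val = M ∧ ((((α i).val / (m / M)) : ℕ) : ZMod M) = v) with hP
  have hPex : ∃ d, P d := by
    refine ⟨m / (m / m.gcd x.val), m / m.gcd x.val, level_dvd x, rfl, (((x.val / (m / (m / m.gcd x.val))) : ℕ)), ?_⟩
    rw [← unitPart_neg hx0 rfl, ← hfibre _ (-x) (level_neg x), ← hfibre _ x rfl]
    exact Ne.symm hx
  -- the top non-even level `M` (least `d = m / M`)
  obtain ⟨M, hMm, hdM, hne⟩ := Nat.find_spec hPex
  have hM0 : M ≠ 0 := fun h0 ↦ hm0 (by rw [h0] at hMm; exact zero_dvd_iff.mp hMm)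
  have hIH : ∀ M' : ℕ, M' ∣ m → M ∣ M' → M' ≠ M → ∀ u : ZMod M',
      #(univ.filter fun i : Fin 8 ↦ m / m.gcd (α i).val = M' ∧ ((((α i).val / (m / M')) : ℕ) : ZMod M') = -u) =
      #(univ.filter fun i : Fin 8 ↦ m / m.gcd (α i).val = M' ∧ ((((α i).val / (m / M')) : ℕ) : ZMod M') = u) := by
    intro M' hM'm hMM' hneM u
    have hM'0 : M' ≠ 0 := fun h0 ↦ hm0 (by rw [h0] at hM'm; exact zero_dvd_iff.mp hM'm)
    have hlt : m / M' < Nat.find hPex := by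
      rw [← hdM]
      obtain ⟨t, rfl⟩ := hMM'
      obtain ⟨s', hs'⟩ := hM'm
      have ht1 : t ≠ 1 := fun h1 ↦ hneM (by rw [h1, mul_one])
      have ht0 : t ≠ 0 := fun h0 ↦ hM'0 (by rw [h0, mul_zero])
      have hs0 : 0 < s' := Nat.pos_of_ne_zero fun h0 ↦ hm0 (by rw [hs', h0, mul_zero])
      have h1 : m / (M * t) = s' := by rw [hs', Nat.mul_div_cancel_left _ (Nat.pos_of_ne_zero hM'0)]
      have h2 : m / M = t * s' := by
        rw [hs', mul_assoc, Nat.mul_div_cancel_left _ (Nat.pos_of_ne_zero hM0)]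
      rw [h1, h2]
      calc s' = 1 * s' := (one_mul s').symm
        _ < t * s' := Nat.mul_lt_mul_of_lt_of_le (by omega) (le_refl s') hs0
    have hmin := Nat.find_min hPex hlt
    simp only [hP, not_exists, not_and, not_not] at hmin
    exact hmin M' hM'm rfl u
  obtain ⟨n, hc, hMn, hn1, b, hbu, hfib⟩ := fibre_of_top_level_eight hm h49 hα hMm hne hIH
  subst hMn
  have hn0 : n ≠ 0 := by omega
  haveI : NeZero n := ⟨hn0⟩
  have h7m : 7 ∣ m := (dvd_mul_right 7 n).trans hMm
  obtain ⟨k, hk⟩ := hMm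
  have hk0 : k ≠ 0 := fun h0 ↦ hm0 (by rw [hk, h0, mul_zero])
  have hdiv7n : m / (7 * n) = k := by rw [hk, Nat.mul_div_cancel_left _ (by positivity)]
  have hdiv7 : m / 7 = n * k := by rw [hk, mul_assoc, Nat.mul_div_cancel_left _ (by norm_num)]
  have hdivn : m / n = 7 * k := by
    rw [hk, show 7 * n * k = n * (7 * k) by ring, Nat.mul_div_cancel_left _ (Nat.pos_of_ne_zero hn0)]
  -- the base point `x₀ = crt⁻¹(0, b)` and `A = (m/(7n))·⟨x₀⟩`
  set x₀ : ZMod (7 * n) := (ZMod.chineseRemainder hc).symm (0, b) with hx₀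
  refine ⟨h7m, ((m / (7 * n) : ℕ) : ZMod m) * ((x₀.val : ℕ) : ZMod m), ?_, 0, by norm_num, fun j hj hj0 ↦ ?_⟩
  · -- `7A ≠ 0`: `7A = (m/n)·⟨x₀⟩` and `n ∤ ⟨x₀⟩` as `x₀ ≡ b (mod n)`, `b` a unit, `n > 1`
    intro h0
    have h7A : (7 : ZMod m) * (((m / (7 * n) : ℕ) : ZMod m) * ((x₀.val : ℕ) : ZMod m)) =
        ((m / n * x₀.val : ℕ) : ZMod m) := by
      rw [hdivn, hdiv7n]; push_cast; ring
    rw [h7A, divMul_natCast_eq_zero_iff ((dvd_mul_left n 7).trans ⟨k, hk⟩)] at h0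
    have hb : (ZMod.castHom (dvd_mul_left n 7) (ZMod n)) x₀ = b := (castHom_crt_symm hc 0 b).2
    rw [ZMod.castHom_apply, ZMod.cast_eq_val, (ZMod.natCast_eq_zero_iff _ _).mpr h0] at hb
    haveI : Fact (1 < n) := ⟨hn1⟩
    exact hbu.ne_zero hb.symm
  · -- the point `A + j(m/7)` is the entry above `crt⁻¹(jn, b)`
    have h7 : Nat.Prime 7 := by decide
    have hjn7 : ¬ 7 ∣ j * n := fun hd ↦ by
      rcases (Nat.Prime.dvd_mul h7).mp hd with hd | hd
      · exact absurd (Nat.le_of_dvd (by omega) hd) (by omega)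
      · exact (Nat.Prime.coprime_iff_not_dvd h7).mp hc hd
    have hy0 : ((j * n : ℕ) : ZMod 7) ≠ 0 := by rwa [Ne, ZMod.natCast_eq_zero_iff]
    haveI : Fact (Nat.Prime 7) := ⟨h7⟩
    have hyu : IsUnit ((j * n : ℕ) : ZMod 7) := isUnit_iff_ne_zero.mpr hy0
    obtain ⟨i, hlev, hup⟩ := hfib hyu.unit
    rw [IsUnit.unit_spec] at hup
    -- `crt⁻¹(jn, b) = x₀ + jn`
    have hxj : (ZMod.chineseRemainder hc).symm (((j * n : ℕ) : ZMod 7), b) = x₀ + ((j * n : ℕ) : ZMod (7 * n)) := by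
      have h1 : ZMod.castHom (dvd_mul_right 7 n) (ZMod 7) (x₀ + ((j * n : ℕ) : ZMod (7 * n))) =
          ((j * n : ℕ) : ZMod 7) := by
        rw [map_add, map_natCast, hx₀, (castHom_crt_symm hc 0 b).1, zero_add]
      have h2 : ZMod.castHom (dvd_mul_left n 7) (ZMod n) (x₀ + ((j * n : ℕ) : ZMod (7 * n))) = b := by
        rw [map_add, map_natCast, hx₀, (castHom_crt_symm hc 0 b).2, Nat.cast_mul, ZMod.natCast_self, mul_zero,
          add_zero]
      rw [← h1, ← h2]
      exact crt_symm_castHom hc _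
    have hαi : α i = ((m / (7 * n) : ℕ) : ZMod m) * ((x₀.val : ℕ) : ZMod m) + (j : ZMod m) * ((m / 7 : ℕ) : ZMod m) := by
      rw [eq_divMul_unitPart hlev, hup, hxj, divMul_val_add ⟨k, hk⟩]
      congr 1
      have hval : (((j * n : ℕ) : ZMod (7 * n))).val = j * n := by
        rw [ZMod.val_natCast, Nat.mod_eq_of_lt (by nlinarith [Nat.pos_of_ne_zero hn0])]
      rw [hval, hdiv7n, hdiv7]
      push_cast
      ring
    rw [← hαi]
    exact Multiset.mem_map_of_mem _ (Finset.mem_univ_val i)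

end ProgressionEight

end PairedNull

end Summit.HodgeConjecture.HodgeConjecture.Theorems.CancelByAnyClaimLattice

end
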